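import Summits.FinalStateConjecture.FinalStateConjecture.Theorems.UniformPhotonSphereChannels.Negative.PotentialBounds
import Summits.FinalStateConjecture.FinalStateConjecture.Theorems.PhotonSphereChannelsEnergyIdentity

/-!
# Crux `UniformPhotonSphereChannels` (K1), negative side — the potential of the horizon-frame
# problem: mass bounds and slow variation on the Rindler chart

Support file of the standing disprover of item stmt-FinalStateConjecture-10045.  With `κ = 1/4M`,
`α = log(κ·)/κ` (on `(A₀, ∞)`), `x(T,X) = (α(X+T) + α(X−T))/2` and the spin-1 Regge–Wheeler
potential `V = ℓ(ℓ+1)(1 − 2M/r)/r²` (`IsTortoiseRadius M r 0`), the horizon-frame potential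
`W(T, X) = V(x) α′(X+T) α′(X−T)` equals `w(x) = e^{−x/2M} V(x)` on `{A₀ < X − |T|}`
(`W_eq_w`), hence (`RWNear.w_le/w_ge/abs_deriv_w_le`)

* `ℓ(ℓ+1)/(27M²) ≤ W ≤ ℓ(ℓ+1)e^{1/2}/(8M²)` (lower bound for `X ≤ 4M`, i.e. `x ≤ 0`);
* `|∂_T W|, |∂_X W| ≤ e^{1/2} · w_max · X/(4M²)` — the mass varies by a relative amount
  `O(X/M²)·(length)`, negligible on a triangle of size `X_e = 4M e^{−ρ/4M}` for a large ball.
[folklore]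
-/

namespace Summit.FinalStateConjecture.FinalStateConjecture.Theorems

open Set Filter Topology Real Literature.Geometry.Lorentzian.ReggeWheeler

noncomputable section

namespace RWNear

open WaveEnergy

variable {M : ℝ} {r : ℝ → ℝ} {L A₀ : ℝ} {α : ℝ → ℝ}

/-- On the Rindler chart the product of the conformal factors is the red-shift:
`α′(A) α′(B) = e^{−x/2M} = 1/(κ²AB)`, `x = (α A + α B)/2`, `κ = 1/4M`. -/
theorem conformal_factor_eq (hM : 0 < M) (hαlog : ∀ a, A₀ < a → α a = Real.log (1 / (4 * M) * a) / (1 / (4 * M)))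
    (hα' : ∀ a, A₀ < a → deriv α a = 1 / (1 / (4 * M) * a)) (hA₀ : 0 ≤ A₀)
    {A B : ℝ} (hA : A₀ < A) (hB : A₀ < B) :
    deriv α A * deriv α B = exp (-((α A + α B) / 2 / (2 * M))) ∧
    exp ((α A + α B) / 2 / (2 * M)) = A * B / (16 * M ^ 2) := by
  have hApos : 0 < A := lt_of_le_of_lt hA₀ hA
  have hBpos : 0 < B := lt_of_le_of_lt hA₀ hB
  have hκA : 0 < 1 / (4 * M) * A := by positivity
  have hκB : 0 < 1 / (4 * M) * B := by positivity
  have hx : (α A + α B) / 2 / (2 * M) = Real.log (1 / (4 * M) * A) + Real.log (1 / (4 * M) * B) := by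
    rw [hαlog A hA, hαlog B hB]; field_simp; ring
  have hexp : exp ((α A + α B) / 2 / (2 * M)) = A * B / (16 * M ^ 2) := by
    rw [hx, exp_add, exp_log hκA, exp_log hκB]; field_simp; ring
  refine ⟨?_, hexp⟩
  rw [exp_neg, hexp, hα' A hA, hα' B hB]
  field_simp
  ring

/-- **`W = w ∘ x` on the chart**: for `A₀ < X − |T|`,
`V(x) α′(X+T) α′(X−T) = e^{−x/2M} V(x)`, `x = (α(X+T) + α(X−T))/2`. -/
theorem W_eq_w (hM : 0 < M) (hαlog : ∀ a, A₀ < a → α a = Real.log (1 / (4 * M) * a) / (1 / (4 * M)))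
    (hα' : ∀ a, A₀ < a → deriv α a = 1 / (1 / (4 * M) * a)) (hA₀ : 0 ≤ A₀)
    (V : ℝ → ℝ) {T X : ℝ} (hz : A₀ < X - |T|) :
    V ((α (X + T) + α (X - T)) / 2) * deriv α (X + T) * deriv α (X - T)
      = V ((α (X + T) + α (X - T)) / 2) * exp (-(((α (X + T) + α (X - T)) / 2) / (2 * M))) := by
  have hA : A₀ < X + T := by linarith [neg_abs_le T]
  have hB : A₀ < X - T := by linarith [le_abs_self T]
  rw [mul_assoc, (conformal_factor_eq hM hαlog hα' hA₀ hA hB).1]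

/-- **Mass bounds on the chart**: `W ≤ ℓ(ℓ+1)e^{1/2}/(8M²)` for `A₀ < X − |T|`, and
`W ≥ ℓ(ℓ+1)/(27M²)` if moreover `X ≤ 4M`. -/
theorem W_bounds (h : IsTortoiseRadius M r 0) (hL : 0 ≤ L)
    (hαlog : ∀ a, A₀ < a → α a = Real.log (1 / (4 * M) * a) / (1 / (4 * M)))
    (hα' : ∀ a, A₀ < a → deriv α a = 1 / (1 / (4 * M) * a)) (hA₀ : 0 ≤ A₀)
    {T X : ℝ} (hz : A₀ < X - |T|) :
    (1 - 2 * M / r ((α (X + T) + α (X - T)) / 2)) * (L / r ((α (X + T) + α (X - T)) / 2) ^ 2)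
        * deriv α (X + T) * deriv α (X - T) ≤ L * exp (1 / 2) / (8 * M ^ 2) ∧
    (X ≤ 4 * M → L / (27 * M ^ 2) ≤
      (1 - 2 * M / r ((α (X + T) + α (X - T)) / 2)) * (L / r ((α (X + T) + α (X - T)) / 2) ^ 2)
        * deriv α (X + T) * deriv α (X - T)) := by
  have hM := h.mass_pos
  have hA : A₀ < X + T := by linarith [neg_abs_le T]
  have hB : A₀ < X - T := by linarith [le_abs_self T]
  have key := W_eq_w hM hαlog hα' hA₀ (fun x => (1 - 2 * M / r x) * (L / r x ^ 2)) hz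
  rw [key]
  refine ⟨w_le h hL _, fun hX4 => w_ge h hL ?_⟩
  -- `x ≤ 0` iff `AB ≤ 16M²`
  have hexp := (conformal_factor_eq hM hαlog hα' hA₀ hA hB).2
  have hAB : (X + T) * (X - T) / (16 * M ^ 2) ≤ 1 := by
    rw [div_le_one (by positivity)]
    have hT : T ^ 2 ≥ 0 := sq_nonneg T
    have hXpos : 0 < X := by linarith [abs_nonneg T]
    nlinarith
  have : exp ((α (X + T) + α (X - T)) / 2 / (2 * M)) ≤ 1 := by rw [hexp]; exact hAB
  have h2 : (α (X + T) + α (X - T)) / 2 / (2 * M) ≤ 0 := by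
    rwa [exp_le_one_iff] at this
  have h3 : (α (X + T) + α (X - T)) / 2 ≤ 0 := by
    by_contra hc; push Not at hc
    have : 0 < (α (X + T) + α (X - T)) / 2 / (2 * M) := div_pos hc (by positivity)
    linarith
  exact h3

/-- **Slow variation on the chart**: for `A₀ < X − |T|` the partials of
`W(T,X) = V(x)α′(X+T)α′(X−T)` are bounded by `e^{1/2} · (ℓ(ℓ+1)e^{1/2}/(8M²)) · X/(4M²)`. -/
theorem W_fderiv_bounds (h : IsTortoiseRadius M r 0) (hL : 0 ≤ L) (hα : ContDiff ℝ 2 α)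
    (hαlog : ∀ a, A₀ < a → α a = Real.log (1 / (4 * M) * a) / (1 / (4 * M)))
    (hα' : ∀ a, A₀ < a → deriv α a = 1 / (1 / (4 * M) * a)) (hA₀ : 0 ≤ A₀)
    {T X : ℝ} (hz : A₀ < X - |T|) :
    |fderiv ℝ (fun z : ℝ × ℝ => (1 - 2 * M / r ((α (z.2 + z.1) + α (z.2 - z.1)) / 2))
        * (L / r ((α (z.2 + z.1) + α (z.2 - z.1)) / 2) ^ 2) * deriv α (z.2 + z.1) * deriv α (z.2 - z.1))
        (T, X) (1, 0)| ≤ exp (1 / 2) * (L * exp (1 / 2) / (8 * M ^ 2)) * X / (4 * M ^ 2) ∧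
    |fderiv ℝ (fun z : ℝ × ℝ => (1 - 2 * M / r ((α (z.2 + z.1) + α (z.2 - z.1)) / 2))
        * (L / r ((α (z.2 + z.1) + α (z.2 - z.1)) / 2) ^ 2) * deriv α (z.2 + z.1) * deriv α (z.2 - z.1))
        (T, X) (0, 1)| ≤ exp (1 / 2) * (L * exp (1 / 2) / (8 * M ^ 2)) * X / (4 * M ^ 2) := by
  have hM := h.mass_pos
  have hXpos : 0 < X := by linarith [abs_nonneg T]
  have hTX : |T| < X := by linarith
  -- the open chart domain and `W = w ∘ x` on it
  set G : Set (ℝ × ℝ) := {z | A₀ < z.2 - |z.1|} with hG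
  have hGo : IsOpen G := isOpen_lt continuous_const (by fun_prop)
  have hzG : (T, X) ∈ G := hz
  set w : ℝ → ℝ := fun x => (1 - 2 * M / r x) * (L / r x ^ 2) * exp (-(x / (2 * M))) with hw
  set xx : ℝ × ℝ → ℝ := fun z => (α (z.2 + z.1) + α (z.2 - z.1)) / 2 with hxx
  set W : ℝ × ℝ → ℝ := fun z : ℝ × ℝ => (1 - 2 * M / r ((α (z.2 + z.1) + α (z.2 - z.1)) / 2))
      * (L / r ((α (z.2 + z.1) + α (z.2 - z.1)) / 2) ^ 2) * deriv α (z.2 + z.1) * deriv α (z.2 - z.1) with hW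
  have hWG : ∀ z ∈ G, W z = w (xx z) := by
    intro z hz'
    have key := W_eq_w hM hαlog hα' hA₀ (fun x => (1 - 2 * M / r x) * (L / r x ^ 2)) (T := z.1) (X := z.2) hz'
    simpa [hW, hw, hxx] using key
  -- derivatives of `xx` along the slices
  have hαd : ∀ a, HasDerivAt α (deriv α a) a := fun a => ((hα.differentiable (by norm_num)) a).hasDerivAt
  have hA : A₀ < X + T := by linarith [neg_abs_le T]
  have hB : A₀ < X - T := by linarith [le_abs_self T]
  have hApos : 0 < X + T := lt_of_le_of_lt hA₀ hA
  have hBpos : 0 < X - T := lt_of_le_of_lt hA₀ hB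
  have hxT : HasDerivAt (fun τ => xx (τ, X)) ((deriv α (X + T) - deriv α (X - T)) / 2) T := by
    have h1 : HasDerivAt (fun τ => α (X + τ)) (deriv α (X + T)) T := by
      simpa [Function.comp_def] using (hαd (X + T)).comp T ((hasDerivAt_id T).const_add X)
    have h2 : HasDerivAt (fun τ => α (X - τ)) (-deriv α (X - T)) T := by
      simpa [Function.comp_def] using (hαd (X - T)).comp T ((hasDerivAt_id T).const_sub X)
    have := (h1.add h2).div_const 2
    simpa [hxx, sub_eq_add_neg] using this
  have hxX : HasDerivAt (fun y => xx (T, y)) ((deriv α (X + T) + deriv α (X - T)) / 2) X := by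
    have h1 : HasDerivAt (fun y => α (y + T)) (deriv α (X + T)) X := by
      simpa [Function.comp_def] using (hαd (X + T)).comp X ((hasDerivAt_id X).add_const T)
    have h2 : HasDerivAt (fun y => α (y - T)) (deriv α (X - T)) X := by
      simpa [Function.comp_def] using (hαd (X - T)).comp X ((hasDerivAt_id X).sub_const T)
    have := (h1.add h2).div_const 2
    simpa [hxx] using this
  -- `w'` and its bound at `x = xx (T, X)`
  have hwd := hasDerivAt_w h L (xx (T, X))
  have hw'b := abs_deriv_w_le h hL (xx (T, X))
  rw [hwd.deriv] at hw'b
  -- size of `e^{x/2M}` and of the slice velocities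
  have hexp := (conformal_factor_eq hM hαlog hα' hA₀ hA hB).2
  have hvel1 : |(deriv α (X + T) - deriv α (X - T)) / 2| = 4 * M * |T| / ((X + T) * (X - T)) := by
    rw [hα' _ hA, hα' _ hB]
    have e1 : (1 / (1 / (4 * M) * (X + T)) - 1 / (1 / (4 * M) * (X - T))) / 2
        = -(4 * M * T / ((X + T) * (X - T))) := by field_simp; ring
    rw [e1, abs_neg, abs_div, abs_mul, abs_of_pos (by positivity : (0 : ℝ) < 4 * M),
      abs_of_pos (mul_pos hApos hBpos)]
  have hvel2 : |(deriv α (X + T) + deriv α (X - T)) / 2| = 4 * M * X / ((X + T) * (X - T)) := by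
    rw [hα' _ hA, hα' _ hB]
    have e1 : (1 / (1 / (4 * M) * (X + T)) + 1 / (1 / (4 * M) * (X - T))) / 2
        = 4 * M * X / ((X + T) * (X - T)) := by field_simp; ring
    rw [e1, abs_of_pos (by positivity)]
  -- the two slices of `W`
  have hWslT : HasDerivAt (fun τ => W (τ, X))
      (-(L * M * exp ((3 * M - r (xx (T, X))) / (2 * M)) / r (xx (T, X)) ^ 3)
        * (1 - 2 * M / r (xx (T, X))) * (1 / (2 * M) + 3 / r (xx (T, X)))
        * ((deriv α (X + T) - deriv α (X - T)) / 2)) T := by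
    have hc := hwd.comp T hxT
    refine hc.congr_of_eventuallyEq ?_
    have : ∀ᶠ τ in 𝓝 T, (τ, X) ∈ G :=
      (Continuous.prodMk_left X).continuousAt.preimage_mem_nhds (hGo.mem_nhds hzG)
    filter_upwards [this] with τ hτ
    exact hWG _ hτ
  have hWslX : HasDerivAt (fun y => W (T, y))
      (-(L * M * exp ((3 * M - r (xx (T, X))) / (2 * M)) / r (xx (T, X)) ^ 3)
        * (1 - 2 * M / r (xx (T, X))) * (1 / (2 * M) + 3 / r (xx (T, X)))
        * ((deriv α (X + T) + deriv α (X - T)) / 2)) X := by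
    have hc := hwd.comp X hxX
    refine hc.congr_of_eventuallyEq ?_
    have : ∀ᶠ y in 𝓝 X, (T, y) ∈ G :=
      (Continuous.prodMk_right T).continuousAt.preimage_mem_nhds (hGo.mem_nhds hzG)
    filter_upwards [this] with y hy
    exact hWG _ hy
  -- `W` is differentiable
  have hVd : Differentiable ℝ fun x => (1 - 2 * M / r x) * (L / r x ^ 2) := by
    have hr := h.differentiable
    have hr0 : ∀ x, r x ≠ 0 := fun x => (h.pos x).ne'
    exact ((differentiable_const _).sub ((differentiable_const _).div hr hr0)).mul
      ((differentiable_const _).div (hr.pow 2) fun x => pow_ne_zero 2 (hr0 x))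
  have hαdiff : Differentiable ℝ α := hα.differentiable (by norm_num)
  have hα'd : Differentiable ℝ (deriv α) := by
    have h2 : ContDiff ℝ (1 + 1) α := by rwa [one_add_one_eq_two]
    exact (contDiff_succ_iff_deriv.mp h2).2.2.differentiable (by norm_num)
  have hxxd : Differentiable ℝ xx := by
    show Differentiable ℝ (fun z : ℝ × ℝ => (α (z.2 + z.1) + α (z.2 - z.1)) / 2)
    fun_prop
  have hd1 : Differentiable ℝ fun z : ℝ × ℝ => (1 - 2 * M / r (xx z)) * (L / r (xx z) ^ 2) :=
    hVd.comp hxxd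
  have hd2 : Differentiable ℝ fun z : ℝ × ℝ => deriv α (z.2 + z.1) := hα'd.comp (by fun_prop)
  have hd3 : Differentiable ℝ fun z : ℝ × ℝ => deriv α (z.2 - z.1) := hα'd.comp (by fun_prop)
  have hWdiff : Differentiable ℝ W := by
    show Differentiable ℝ (fun z : ℝ × ℝ => (1 - 2 * M / r ((α (z.2 + z.1) + α (z.2 - z.1)) / 2))
      * (L / r ((α (z.2 + z.1) + α (z.2 - z.1)) / 2) ^ 2) * deriv α (z.2 + z.1) * deriv α (z.2 - z.1))
    exact (hd1.mul hd2).mul hd3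
  have e1 := (hasDerivAt_slice_fst hWdiff T X).unique hWslT
  have e2 := (hasDerivAt_slice_snd hWdiff T X).unique hWslX
  -- the common bound `|w'(x)| · velocity`
  have hred := hw'b
  rw [hexp] at hred
  have hc0 : 0 ≤ exp (1 / 2) * (L * exp (1 / 2) / (8 * M ^ 2)) := by positivity
  have hABne : (X + T) * (X - T) ≠ 0 := (mul_pos hApos hBpos).ne'
  constructor
  · rw [show fderiv ℝ W (T, X) (1, 0) = _ from e1, abs_mul, hvel1]
    calc _ ≤ (exp (1 / 2) / M * (L * exp (1 / 2) / (8 * M ^ 2)) * ((X + T) * (X - T) / (16 * M ^ 2)))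
          * (4 * M * |T| / ((X + T) * (X - T))) :=
          mul_le_mul_of_nonneg_right hred (by positivity)
      _ = exp (1 / 2) * (L * exp (1 / 2) / (8 * M ^ 2)) * |T| / (4 * M ^ 2) := by
          field_simp
          ring
      _ ≤ exp (1 / 2) * (L * exp (1 / 2) / (8 * M ^ 2)) * X / (4 * M ^ 2) :=
          div_le_div_of_nonneg_right (mul_le_mul_of_nonneg_left hTX.le hc0) (by positivity)
  · rw [show fderiv ℝ W (T, X) (0, 1) = _ from e2, abs_mul, hvel2]
    calc _ ≤ (exp (1 / 2) / M * (L * exp (1 / 2) / (8 * M ^ 2)) * ((X + T) * (X - T) / (16 * M ^ 2)))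
          * (4 * M * X / ((X + T) * (X - T))) :=
          mul_le_mul_of_nonneg_right hred (by positivity)
      _ = exp (1 / 2) * (L * exp (1 / 2) / (8 * M ^ 2)) * X / (4 * M ^ 2) := by
          field_simp
          ring

end RWNear

end

end Summit.FinalStateConjecture.FinalStateConjecture.Theorems
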